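import Summits.BirchSwinnertonDyer.BirchSwinnertonDyer.Theses.ShaPrimaryTransfer
import Literature.NumberTheory.EllipticCurves.KubertTate171ShaSeven
import Literature.NumberTheory.EllipticCurves.KubertTateSevenRational
import HarnessLib

/-!
# Crux `OneFiniteShaComponent` (stmt-BirchSwinnertonDyer-22357): the door at `7`

Helper for item **stmt-BirchSwinnertonDyer-22357** (`OneFiniteShaComponent`, «O»: every elliptic `E/ℚ` has SOME
prime `p₀` with `t_{p₀}(E) = corank_{ℤ_{p₀}} Ш(E)[p₀^∞] = 0) of route `ShaPrimaryTransfer`; it closes nothing —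
O is conjecture-grade at analytic rank `≥ 2` and **BSD is NOT proved by this file**. After the doors at `2`, `3`
and `5`, the door at the last torsion prime `7` (Mazur): the GENERIC `μ₇`-descent engine
(`Literature.….KubertTateSevenMuDescent[Box]`, T. Fisher 2001) on the universal `7`-torsion curve
`E_{m,n} = kubertTateSeven m n` certifies O, witness `p₀ = 7`, by descent alone:

* §1 INSTANCE (unconditional): `oneFiniteShaComponent_171` — `E_{17} = [−271, −4624, −4624, 0, 0]` (rank `1`);
  the instances `E_{−8/5}` (RANK `2`), `E_{−11/5}` (rank `2`), `E_{−8}` (rank `1`) are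
  `ShaPrimaryTransferDoorAtSeven.oneFiniteShaComponent_E₂/E₂'/E₁` of `…FiniteShaComponentTransferDoorAtSeven`.
* §2 CLASS-WIDE SHAPE for EVERY elliptic `E/ℚ` with a rational point of order `7`: such an `E` is `ℚ`-isomorphic to
  some `E_{m,n}` (`KubertTateSevenRational`), and O for `E` with witness `7` follows from the box criterion on that
  model — `oneFiniteShaComponent_of_smul_eq_kubertTateSeven`: if `C • E = E_{m,n}` is tame (`7 ∤ Δ`, no bad prime
  `≡ 1 (mod 7)`), has a good prime `q ≤ 23` (`q ≠ 7`), a rational point `P₁` with `49 P₁ ≠ O`, and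
  `rank E(ℚ) + 1 ≥ ω(mn(m−n))`, then `t₇(E) = 0`.

## References

* [SilvermanAEC2009] J. H. Silverman, *AEC*, 2nd ed., Thm. X.4.2, Exercise 10.1, X.§4 Rem. 4.1.1.
* [Fisher2001FiveSevenDescent] T. Fisher, JEMS 3 (2001) 169–201, §§1–2.
* [Kubert1976] D. S. Kubert, Proc. LMS (3) 33 (1976), Table 3 (`N = 7`).
-/

noncomputable section

set_option linter.dupNamespace false

open WeierstrassCurve
open Literature.NumberTheory.EllipticCurves
open Summit.BirchSwinnertonDyer.BirchSwinnertonDyer.Theses.ShaPrimaryTransfer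

namespace Summit.BirchSwinnertonDyer.BirchSwinnertonDyer.Theorems.ShaPrimaryTransferDoorAtSevenO

/-! ## §1 Instance: O with witness `p₀ = 7`, unconditionally -/

/-- **O for `E_{17}` (rank `1`), witness `7`.** [cite: SilvermanAEC2009, Thm. X.4.2(a)] [cite: Fisher2001FiveSevenDescent, §2] -/
theorem oneFiniteShaComponent_171 :
    haveI := KubertTate171Descent.isElliptic
    ∃ (p : ℕ) (_ : Fact p.Prime), (kubertTateSeven (((17 : ℤ) : ℚ)) (((1 : ℤ) : ℚ))).shaCorank p = 0 :=
  ⟨7, ⟨by norm_num⟩, KubertTate171Descent.shaCorank_seven_eq_zero⟩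

/-! ## §2 Every elliptic curve over `ℚ` with a rational `7`-torsion point: O from the box on its `E_{m,n}`-model -/

/-- **`t₇(E) = 0` for an elliptic `E/ℚ` whose Kubert–Tate model `C • E = E_{m,n}` is tame and has a full box**
(`7 ∤ Δ(E_{m,n})`, no bad prime `≡ 1 (mod 7)`, a good prime `q ≤ 23`, `q ≠ 7`, a rational point `P₁` with
`49 P₁ ≠ O`, and `rank E(ℚ) + 1 ≥ ω(mn(m−n))`): the class-wide `μ₇`-descent
(`KubertTateSevenMuDescent.shaCorank_seven_eq_zero_of_le_mordellWeilRank_succ`) on the model, carried back along `C`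
(`shaCorank_eq_zero_iff_of_smul_eq`, `mordellWeilRank_eq_of_smul_eq`). Every elliptic `E/ℚ` with a rational point of
order `7` HAS such a model `C • E = E_{m,n}` (`exists_variableChange_eq_kubertTateSeven_of_addOrderOf_eq_seven`); the
hypotheses are then conditions on `(m, n)` and on the rank. [cite: SilvermanAEC2009, Thm. X.4.2] [cite: Fisher2001FiveSevenDescent, §2] -/
theorem shaCorank_seven_eq_zero_of_smul_eq_kubertTateSeven (W : WeierstrassCurve ℚ) [W.IsElliptic] (m n : ℤ)
    [(kubertTateSeven (m : ℚ) (n : ℚ)).IsElliptic] (C : VariableChange ℚ)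
    (hC : C • W = kubertTateSeven (m : ℚ) (n : ℚ))
    (P₁ : geomPoints (kubertTateSeven (m : ℚ) (n : ℚ)))
    (hP₁ : ∀ σ : Field.absoluteGaloisGroup ℚ, σ • P₁ = P₁) (h49 : ((49 : ℕ) : ℤ) • P₁ ≠ 0)
    (h7 : ¬ (7 : ℤ) ∣ (kubertTateSeven m n).Δ)
    (h1 : ∀ p : ℕ, p.Prime → (p : ℤ) ∣ (kubertTateSeven m n).Δ → p % 7 ≠ 1)
    (q : ℕ) [Fact q.Prime] (hq7 : q ≠ 7) (hq23 : 2 * q + 1 < 49) (hq : ¬ (q : ℤ) ∣ (kubertTateSeven m n).Δ)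
    (hr : (m * n * (m - n)).natAbs.primeFactors.card ≤ W.mordellWeilRank + 1) :
    W.shaCorank 7 = 0 := by
  haveI : Fact (Nat.Prime 7) := ⟨by norm_num⟩
  have h7tors := KubertTateSevenTorsion.natCard_torsionBy_seven m n q hq7 hq23 hq
  rw [mordellWeilRank_eq_of_smul_eq W _ C hC] at hr
  have h := KubertTateSevenMuDescent.shaCorank_seven_eq_zero_of_le_mordellWeilRank_succ m n P₁ hP₁ h49 h7 h1
    h7tors hr
  exact (shaCorank_eq_zero_iff_of_smul_eq W _ C hC 7).2 h

/-- **O (witness `7`) for such curves.** [cite: SilvermanAEC2009, Thm. X.4.2] [cite: Fisher2001FiveSevenDescent, §2] -/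
theorem oneFiniteShaComponent_of_smul_eq_kubertTateSeven (W : WeierstrassCurve ℚ) [W.IsElliptic] (m n : ℤ)
    [(kubertTateSeven (m : ℚ) (n : ℚ)).IsElliptic] (C : VariableChange ℚ)
    (hC : C • W = kubertTateSeven (m : ℚ) (n : ℚ))
    (P₁ : geomPoints (kubertTateSeven (m : ℚ) (n : ℚ)))
    (hP₁ : ∀ σ : Field.absoluteGaloisGroup ℚ, σ • P₁ = P₁) (h49 : ((49 : ℕ) : ℤ) • P₁ ≠ 0)
    (h7 : ¬ (7 : ℤ) ∣ (kubertTateSeven m n).Δ)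
    (h1 : ∀ p : ℕ, p.Prime → (p : ℤ) ∣ (kubertTateSeven m n).Δ → p % 7 ≠ 1)
    (q : ℕ) [Fact q.Prime] (hq7 : q ≠ 7) (hq23 : 2 * q + 1 < 49) (hq : ¬ (q : ℤ) ∣ (kubertTateSeven m n).Δ)
    (hr : (m * n * (m - n)).natAbs.primeFactors.card ≤ W.mordellWeilRank + 1) :
    ∃ (p : ℕ) (_ : Fact p.Prime), W.shaCorank p = 0 :=
  ⟨7, ⟨by norm_num⟩, shaCorank_seven_eq_zero_of_smul_eq_kubertTateSeven W m n C hC P₁ hP₁ h49 h7 h1 q hq7 hq23 hq hr⟩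

/-- **T (by name) meets the class-wide door at `7`**: granting `FiniteShaComponentTransfer`, every elliptic `E/ℚ`
with a tame, box-full Kubert–Tate model as above has `t_p(E) = 0` for EVERY prime `p`.
[cite: SilvermanAEC2009, Thm. X.4.2] -/
theorem forall_shaCorank_eq_zero_of_transfer_of_smul_eq_kubertTateSeven (hT : FiniteShaComponentTransfer)
    (W : WeierstrassCurve ℚ) [W.IsElliptic] (m n : ℤ)
    [(kubertTateSeven (m : ℚ) (n : ℚ)).IsElliptic] (C : VariableChange ℚ)
    (hC : C • W = kubertTateSeven (m : ℚ) (n : ℚ))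
    (P₁ : geomPoints (kubertTateSeven (m : ℚ) (n : ℚ)))
    (hP₁ : ∀ σ : Field.absoluteGaloisGroup ℚ, σ • P₁ = P₁) (h49 : ((49 : ℕ) : ℤ) • P₁ ≠ 0)
    (h7 : ¬ (7 : ℤ) ∣ (kubertTateSeven m n).Δ)
    (h1 : ∀ p : ℕ, p.Prime → (p : ℤ) ∣ (kubertTateSeven m n).Δ → p % 7 ≠ 1)
    (q : ℕ) [Fact q.Prime] (hq7 : q ≠ 7) (hq23 : 2 * q + 1 < 49) (hq : ¬ (q : ℤ) ∣ (kubertTateSeven m n).Δ)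
    (hr : (m * n * (m - n)).natAbs.primeFactors.card ≤ W.mordellWeilRank + 1) (p : ℕ) [Fact p.Prime] :
    W.shaCorank p = 0 :=
  haveI : Fact (Nat.Prime 7) := ⟨by norm_num⟩
  hT W 7 p (shaCorank_seven_eq_zero_of_smul_eq_kubertTateSeven W m n C hC P₁ hP₁ h49 h7 h1 q hq7 hq23 hq hr)

end Summit.BirchSwinnertonDyer.BirchSwinnertonDyer.Theorems.ShaPrimaryTransferDoorAtSevenO

end
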